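import Summits.QuantumFields.BalabanUV.T4Continuum.Support.RegionGaugeResolventSplit

/-!
# T⁴ programme, spine node NE2 (U1a), sub-row Δ1 «NE2⁰-Dirichlet» — PRINT's TWO-ZONE SCALAR DATA ON THE OUTER REGION:
# `Q′ = [block means on Ω₁-blocks ; scaled δ on Λ₀-sites]` (so `N(Q′) = {λ = 0 on Λ₀, Q′₁λ = 0}` and `Q′Q′ᴴ = n^{−d}·1`),
# `Δ′(Ω₀) = (−Δ + a′Π′)↾Ω₀ + a′n²·1_{Λ₀}`, `G′(Ω₀) = Δ′(Ω₀)⁻¹` with `‖G′‖ ≤ γ′⁻¹`, and «on `N(Q′)` `Δ′` is the Dirichlet Laplacian of `Ω₀`»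

NE2 formalisation swarm `b2b-balaban-t4-ne2-formalise-*`, LEAF PROVER 05 (gen 10), own-initiative supplier brick «Δ1-COLLAR-GAUGE», file 1 of 2
(file 2 `Support/RegionTwoZoneGauge`: the `SliceData` of print's collared vector operator and «G(Ω₀) exists»; companion
`Support/RegionTwoZoneLocal`: the LOCAL operator).  For gen 16's ITEM 1 = the dictionary fork G-ne2p1-g15-6 (owner R44 (c) / R45 (d); T4-DAG
writer's ANSWER Q51 «type the collar», journal 2026-08-21 l.24324; this seat's located readings (R1)/(R2), INTENT l.24547).

WHAT IS PRINTED.  [Balaban1984PropagatorsII] p.224 (2.7) «λ = 0 on Λ₀, Q′_jλ = 0 on Λ_j, j = 1, …, k», p.225 «we assume that (Q′₀λ)(x) = λ(x),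
x ∈ Λ₀» and (2.14) «⟨λ, Q′*aQ′λ⟩ = Σ_{j=0}^{k} Σ_{y∈Λ_j^{(j)}} a_j (L^jη)^d |(Q′_jλ)(y)|²»; [Balaban1985BackgroundPropagators] p.394 (3.21)
«N(Q′) = {λ : Q′λ = 0}», (3.24) «Δ′_a = (Δ^η_U + Q′*aQ′)↾Ω₀», «The operator Δ^η_U↾Ω₀ is the covariant Laplace operator with Dirichlet boundary
conditions on Ω₀ᶜ».

WHAT THIS FILE TYPES AND PROVES ([folklore] finite-dimensional bookkeeping over landed modules BY NAME; `U = 1`; 0 sorry).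
 * §0 **`factor_of_ker_inv`** / `factor_of_ker`: a matrix killing `ker Q′` factors through `Q′` when `Q′Q′ᴴ` is invertible (resp. `= θ·1`) —
   produces «Q∂ = ∂₁Q′» intertwiners from kernel inclusions (file 2; graded averagings with block-diagonal Gram matrices included).
 * §1 `collarSite` (`Λ₀ = Ω₀ ∖ Ω₁`), `Q1` (the `Ω₁`-block means read on `Ω₀`), `selS` (the `Λ₀`-site coordinates), `sC = √(n^d)⁻¹`,
   **`QsC = fromRows Q1 (sC·selS)`**, `ker_QsC_iff`, **`QsC_mul_conjTranspose (hsub) : Q′Q′ᴴ = n^{−d}·1`**;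
   **`DpC = DOm(S₀) + a′n²·selSᴴselS`** (road P2's Dirichlet-plus-block-mass operator of the OUTER region + the `j = 0` site mass; the block-mass
   rows on collar blocks are a modelling surplus over print's (2.14)/(3.24) that VANISHES on `N(Q′)` — `DpC_mulVec_of_ker` — and therefore does not
   change the projection `R` onto `Δ′N(Q′)`), `coercive_DpC` (`γ′ = gammaPs d a′`, uniform), `GOmC = DpC⁻¹`, `opNorm_GOmC_le`, `DpC_mul_GOmC`,
   `GOmC_mul_DpC`, `QOm_eq_zero_of_ker`, **`DpC_mulVec_of_ker : Q′λ = 0 → Δ′λ = ∂_{Ω₀}ᴴ(∂_{Ω₀}λ)`**.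

HONEST FRAMING (T4-DAG p. 1).  Model level (two zones, ONE averaging scale, finite torus); constants OURS; nothing printed is a hypothesis or a
conclusion; no estimate beyond the uniform `‖G′(Ω₀)‖ ≤ γ′⁻¹`; [B9]'s graded layers and the background are not modelled; the c5/B0 ruling stays with
its owners; NE2 (U1a) NOT proved; spine PROVED 0/9 unchanged; NOT [B9] (3.16)/(3.23)–(3.27) as printed; NOT infinite volume / mass gap / Clay.
HONEST DEPENDENCY: continuum YM on T⁴ ⇐ BetaPertH ∧ nine spine estimates (0/9 proved); BetaPertH ⇐ (D1) ∧ (D4) ∧ CAP+tail; G-an2-4 gates asym,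
D1 and NE2/3/4.  No `sorry`.
-/

noncomputable section

open scoped BigOperators ComplexConjugate Matrix Matrix.Norms.L2Operator
open Finset

namespace Summit.QuantumFields.BalabanUV.T4Continuum.RegionTwoZoneScalar

open Literature.MathematicalPhysics.QuantumFieldTheory.Balaban1983to89.B5Prop11Plancherel (Tor fine unitVec)
open Literature.MathematicalPhysics.QuantumFieldTheory.Balaban1983to89.B5Prop11Lower (nsq nsq_nonneg)
open Literature.MathematicalPhysics.QuantumFieldTheory.Balaban1983to89.B5Block118 (QsOp)
open Literature.MathematicalPhysics.QuantumFieldTheory.Balaban1983to89.B5Blocks16 (blockOf)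
open Summit.QuantumFields.BalabanUV.T4Continuum
open Summit.QuantumFields.BalabanUV.T4Continuum.SubtypeCompression (Coercive coercive_toBlock isUnit_det_of_coercive opNorm_inv_le_of_coercive)
open Summit.QuantumFields.BalabanUV.T4Continuum.ScalarAveragedPropagator (gammaPs gammaPs_pos)
open Summit.QuantumFields.BalabanUV.T4Continuum.RegionGaugeSlice (form_gram)
open Summit.QuantumFields.BalabanUV.T4Continuum.RegionScalarCompression (QOm)
open Summit.QuantumFields.BalabanUV.T4Continuum.RegionGaugeFixedVector (gradR QsOp_apply_eq_zero DOm_mulVec_of_ker)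
open Summit.QuantumFields.BalabanUV.T4Continuum.RegionGaugeSliceOrthRegion (QOm_mul_conjTranspose)
open Summit.QuantumFields.BalabanUV.T4Continuum.ScalarGaugeProjectionUnit (ext_of_mulVec_rect)
open Summit.QuantumFields.BalabanUV.Beta.GAN24.DirichletBoxCompression (DOm coercive_DeltaPs DOm_isHermitian)
open Summit.QuantumFields.BalabanUV.Beta.GAN24.DirichletBoxTrace (blockReg)

variable {d : ℕ} (n : ℕ) [NeZero n] (M : Fin d → ℕ) [hM : ∀ μ, NeZero (M μ)] (a' : ℝ) (S₀ S₁ : Tor M → Prop)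
  [DecidablePred S₀] [DecidablePred S₁]

/-! ## §0 A generic tool -/

/-- **FACTORISATION THROUGH A SURJECTIVE AVERAGING**: if `Qs·Qsᴴ` is invertible and a matrix `T` kills `ker Qs`, then
`T = (T·Qsᴴ·(Qs·Qsᴴ)⁻¹)·Qs` — used to produce the intertwiner of «Q∂ = ∂₁Q′» from a kernel inclusion; stated for a GENERAL Gram matrix so that
graded (block-diagonal, per-scale) averagings are covered. [folklore] -/
theorem factor_of_ker_inv {p q u : Type*} [Fintype p] [DecidableEq p] [Fintype q] [DecidableEq q] [Fintype u] [DecidableEq u]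
    (T : Matrix p q ℂ) (Qs : Matrix u q ℂ) (hQQ : IsUnit (Qs * Qsᴴ).det) (hker : ∀ lam, Qs *ᵥ lam = 0 → T *ᵥ lam = 0) :
    T = (T * Qsᴴ * (Qs * Qsᴴ)⁻¹) * Qs := by
  refine ext_of_mulVec_rect fun lam => ?_
  -- the residual `lam − Qsᴴ (QsQsᴴ)⁻¹ Qs lam` lies in `ker Qs`
  have hres : Qs *ᵥ (lam - Qsᴴ *ᵥ ((Qs * Qsᴴ)⁻¹ *ᵥ (Qs *ᵥ lam))) = 0 := by
    rw [Matrix.mulVec_sub, Matrix.mulVec_mulVec, Matrix.mulVec_mulVec, Matrix.mul_nonsing_inv _ hQQ,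
      Matrix.one_mulVec, sub_self]
  have h0 := hker _ hres
  rw [Matrix.mulVec_sub, sub_eq_zero] at h0
  rw [h0, ← Matrix.mulVec_mulVec, ← Matrix.mulVec_mulVec, ← Matrix.mulVec_mulVec]

/-- the co-isometric case `Qs·Qsᴴ = θ·1` (`θ ≠ 0`): `T = (θ⁻¹·T·Qsᴴ)·Qs`. [folklore] -/
theorem factor_of_ker {p q u : Type*} [Fintype p] [DecidableEq p] [Fintype q] [DecidableEq q] [Fintype u] [DecidableEq u]
    (T : Matrix p q ℂ) (Qs : Matrix u q ℂ)
    {θ : ℝ} (hθ : θ ≠ 0) (hQQ : Qs * Qsᴴ = (θ : ℂ) • (1 : Matrix u u ℂ)) (hker : ∀ lam, Qs *ᵥ lam = 0 → T *ᵥ lam = 0) :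
    T = ((((θ⁻¹ : ℝ)) : ℂ) • (T * Qsᴴ)) * Qs := by
  refine ext_of_mulVec_rect fun lam => ?_
  have hθc : (θ : ℂ) ≠ 0 := by exact_mod_cast hθ
  -- the residual `lam − θ⁻¹ Qsᴴ Qs lam` lies in `ker Qs`
  have hres : Qs *ᵥ (lam - (((θ⁻¹ : ℝ) : ℂ) • (Qsᴴ *ᵥ (Qs *ᵥ lam)))) = 0 := by
    rw [Matrix.mulVec_sub, Matrix.mulVec_smul, Matrix.mulVec_mulVec, hQQ, Matrix.smul_mulVec, Matrix.one_mulVec, smul_smul]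
    push_cast
    rw [inv_mul_cancel₀ hθc, one_smul, sub_self]
  have h0 := hker _ hres
  rw [Matrix.mulVec_sub, Matrix.mulVec_smul, sub_eq_zero] at h0
  rw [h0, Matrix.smul_mul, Matrix.smul_mulVec, ← Matrix.mulVec_mulVec, ← Matrix.mulVec_mulVec]

/-! ## §1 The collared scalar data on `Ω₀` -/

/-- the COLLAR SITES `Λ₀ = Ω₀ ∖ Ω₁`. [cite: Balaban1985BackgroundPropagators, p.393 (shape: Λ₀ = Ω₀ ∖ Ω₁)] [folklore] -/
def collarSite : Tor (fine n M) → Prop := fun x => blockReg n M S₀ x ∧ ¬ blockReg n M S₁ x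

/-- decidability. [folklore] -/
instance decCollarSite : DecidablePred (collarSite n M S₀ S₁) := fun x =>
  inferInstanceAs (Decidable (blockReg n M S₀ x ∧ ¬ blockReg n M S₁ x))

omit [DecidablePred S₁] in
/-- the `Ω₁`-BLOCK MEANS read on the sites of `Ω₀` (the `j = 1` rows of print's `Q′`). [cite: Balaban1985BackgroundPropagators, (3.18) p.393 (shape)] [folklore] -/
def Q1 : Matrix {y // S₁ y} {x // blockReg n M S₀ x} ℂ := (QsOp n M).toBlock S₁ (blockReg n M S₀)

/-- the `Λ₀`-SITE COORDINATES of a scalar on `Ω₀` (the `j = 0` rows «(Q′₀λ)(x) = λ(x)» before scaling). [cite: Balaban1984PropagatorsII, p.225 (shape: Q′₀ = id on Λ₀)] [folklore] -/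
def selS : Matrix {x // collarSite n M S₀ S₁ x} {x // blockReg n M S₀ x} ℂ := fun c x => if (c : Tor (fine n M)) = (x : Tor (fine n M)) then 1 else 0

omit [DecidablePred S₁] in
/-- `selS` reads off the collar-site values. [folklore] -/
theorem selS_mulVec (lam : {x // blockReg n M S₀ x} → ℂ) : selS n M S₀ S₁ *ᵥ lam = fun c => lam ⟨c.1, c.2.1⟩ := by
  funext c
  rw [Matrix.mulVec, dotProduct, Finset.sum_eq_single ⟨c.1, c.2.1⟩]
  · simp [selS]
  · intro x _ hx
    have : (c : Tor (fine n M)) ≠ (x : Tor (fine n M)) := fun h => hx (Subtype.ext h.symm)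
    simp [selS, this]
  · intro h; exact absurd (Finset.mem_univ _) h

/-- `selS·selSᴴ = 1`. [folklore] -/
theorem selS_mul_conjTranspose : selS n M S₀ S₁ * (selS n M S₀ S₁)ᴴ = 1 := by
  refine ext_of_mulVec_rect fun v => ?_
  rw [← Matrix.mulVec_mulVec, Matrix.one_mulVec, selS_mulVec]
  funext c
  simp only [Matrix.mulVec, dotProduct, Matrix.conjTranspose_apply, selS]
  rw [Finset.sum_eq_single c]
  · simp
  · intro c' _ hc'
    have : ¬ ((c' : Tor (fine n M)) = (c : Tor (fine n M))) := fun h => hc' (Subtype.ext h)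
    simp [this]
  · intro h; exact absurd (Finset.mem_univ _) h

/-- the scaling `s = √(n^d)⁻¹` of the `j = 0` rows (so that `Q′Q′ᴴ` is ONE multiple of the identity; `N(Q′)` is scale-free). [folklore] -/
def sC : ℝ := (Real.sqrt ((n : ℝ) ^ d))⁻¹

omit [NeZero n] in
/-- `s² = n^{−d}`. [folklore] -/
theorem sC_mul_sC : ((sC (d := d) n : ℝ) : ℂ) * ((sC (d := d) n : ℝ) : ℂ) = ((((n : ℝ) ^ d)⁻¹ : ℝ) : ℂ) := by
  rw [← Complex.ofReal_mul, sC, ← mul_inv, Real.mul_self_sqrt (by positivity)]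

/-- `s ≠ 0`. [folklore] -/
theorem sC_ne_zero : ((sC (d := d) n : ℝ) : ℂ) ≠ 0 := by
  have : 0 < sC (d := d) n := by
    unfold sC
    exact inv_pos.mpr (Real.sqrt_pos.mpr (pow_pos (by exact_mod_cast Nat.pos_of_ne_zero (NeZero.ne n)) d))
  exact_mod_cast this.ne'

/-- **PRINT's TWO-ZONE SCALAR AVERAGING** `Q′ = [Q′₁ on Ω₁-blocks ; s·δ on Λ₀-sites]` on `L²(Ω₀)`; its kernel is `N(Q′) = {λ = 0 on Λ₀,
Q′₁λ = 0}`. [cite: Balaban1984PropagatorsII, (2.7) p.224 (shape: N(Q′))] [folklore] -/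
def QsC : Matrix ({y // S₁ y} ⊕ {x // collarSite n M S₀ S₁ x}) {x // blockReg n M S₀ x} ℂ :=
  Matrix.fromRows (Q1 n M S₀ S₁) (((sC (d := d) n : ℝ) : ℂ) • selS n M S₀ S₁)

omit [DecidablePred S₁] in
/-- the kernel of `Q′`, componentwise. [folklore] -/
theorem ker_QsC_iff (lam : {x // blockReg n M S₀ x} → ℂ) :
    QsC n M S₀ S₁ *ᵥ lam = 0 ↔ Q1 n M S₀ S₁ *ᵥ lam = 0 ∧ selS n M S₀ S₁ *ᵥ lam = 0 := by
  rw [QsC, Matrix.fromRows_mulVec, Matrix.smul_mulVec]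
  constructor
  · intro h
    refine ⟨?_, ?_⟩
    · funext y; exact congrFun h (Sum.inl y)
    · have h2 : (((sC (d := d) n : ℝ) : ℂ) • (selS n M S₀ S₁ *ᵥ lam)) = 0 := by funext c; exact congrFun h (Sum.inr c)
      exact (smul_eq_zero.mp h2).resolve_left (sC_ne_zero n)
  · rintro ⟨h1, h2⟩
    funext i
    rcases i with y | c
    · simp only [Sum.elim_inl, Pi.zero_apply, h1]
    · simp only [Sum.elim_inr, Pi.zero_apply, h2, smul_zero]

omit [DecidablePred S₁] in
/-- a sum over the sites of `Ω₀` of a function vanishing off the blocks of `S₁` is the full torus sum (for `S₁ ≤ S₀`). [folklore] -/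
theorem sum_reg_eq {f : Tor (fine n M) → ℂ} (hsub : ∀ y, S₁ y → S₀ y) (hf : ∀ x, ¬ blockReg n M S₁ x → f x = 0) :
    ∑ x : {x // blockReg n M S₀ x}, f x = ∑ x, f x := by
  rw [← Fintype.sum_subtype_add_sum_subtype (blockReg n M S₀) f]
  have h2 : ∑ x : {x // ¬ blockReg n M S₀ x}, f x = 0 :=
    Finset.sum_eq_zero fun x _ => hf x fun hx => x.2 (hsub _ hx)
  rw [h2, add_zero]

omit [DecidablePred S₁] in
/-- the zero-extension of an `Ω₁`-scalar to `Ω₀`, paired against any kernel: the sum lives on `Ω₁` (`S₁ ≤ S₀`). [folklore] -/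
theorem sum_extend [DecidablePred S₁] (hsub : ∀ y, S₁ y → S₀ y) (g : Tor (fine n M) → ℂ) (lam₁ : {x // blockReg n M S₁ x} → ℂ) :
    ∑ x : {x // blockReg n M S₀ x}, g x * (if h : blockReg n M S₁ x.1 then lam₁ ⟨x.1, h⟩ else 0)
      = ∑ x : {x // blockReg n M S₁ x}, g x * lam₁ x := by
  have hz : ∀ x : Tor (fine n M), ¬ blockReg n M S₁ x → (g x * if h : blockReg n M S₁ x then lam₁ ⟨x, h⟩ else 0) = 0 :=
    fun x hx => by rw [dif_neg hx, mul_zero]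
  rw [sum_reg_eq n M S₀ S₁ hsub (f := fun x => g x * if h : blockReg n M S₁ x then lam₁ ⟨x, h⟩ else 0) hz,
    ← Fintype.sum_subtype_add_sum_subtype (blockReg n M S₁) (fun x => g x * if h : blockReg n M S₁ x then lam₁ ⟨x, h⟩ else 0)]
  have h2 : ∑ x : {x // ¬ blockReg n M S₁ x}, (g x * if h : blockReg n M S₁ x.1 then lam₁ ⟨x.1, h⟩ else 0) = 0 :=
    Finset.sum_eq_zero fun x _ => hz x x.2
  rw [h2, add_zero]
  exact Finset.sum_congr rfl fun x _ => by rw [dif_pos x.2]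

/-- `Q1·Q1ᴴ = n^{−d}·1` (the block means are read on all of their blocks, since `S₁ ≤ S₀`). [folklore] -/
theorem Q1_mul_conjTranspose (hsub : ∀ y, S₁ y → S₀ y) :
    Q1 n M S₀ S₁ * (Q1 n M S₀ S₁)ᴴ = ((((n : ℝ) ^ d)⁻¹ : ℝ) : ℂ) • (1 : Matrix {y // S₁ y} {y // S₁ y} ℂ) := by
  rw [← QOm_mul_conjTranspose n M S₁]
  ext y y'
  simp only [Matrix.mul_apply, Matrix.conjTranspose_apply, Q1, QOm, Matrix.toBlock_apply]
  have hz : ∀ x : Tor (fine n M), ¬ blockReg n M S₁ x → QsOp n M y.1 x * star (QsOp n M y'.1 x) = 0 := fun x hx => by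
    have : blockOf n M x ≠ y.1 := fun h => hx (by show S₁ (blockOf n M x); rw [h]; exact y.2)
    rw [QsOp_apply_eq_zero n M this, zero_mul]
  rw [sum_reg_eq n M S₀ S₁ hsub hz, ← Fintype.sum_subtype_add_sum_subtype (blockReg n M S₁)
    (fun x => QsOp n M y.1 x * star (QsOp n M y'.1 x))]
  have h2 : ∑ x : {x // ¬ blockReg n M S₁ x}, QsOp n M y.1 x * star (QsOp n M y'.1 x) = 0 :=
    Finset.sum_eq_zero fun x _ => hz x x.2
  rw [h2, add_zero]

omit [DecidablePred S₁] in
/-- `Q1·selSᴴ = 0` (a collar site lies in no block of `S₁`). [folklore] -/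
theorem Q1_mul_selS_conjTranspose : Q1 n M S₀ S₁ * (selS n M S₀ S₁)ᴴ = 0 := by
  ext y c
  simp only [Matrix.mul_apply, Matrix.conjTranspose_apply, Q1, Matrix.toBlock_apply, selS, Matrix.zero_apply]
  refine Finset.sum_eq_zero fun x _ => ?_
  by_cases h : (c : Tor (fine n M)) = (x : Tor (fine n M))
  · have hc : ¬ blockReg n M S₁ x.1 := h ▸ c.2.2
    have : blockOf n M x.1 ≠ y.1 := fun e => hc (by show S₁ (blockOf n M x.1); rw [e]; exact y.2)
    rw [QsOp_apply_eq_zero n M this, zero_mul]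
  · simp [h]

/-- **`Q′Q′ᴴ = n^{−d}·1`**. [folklore] -/
theorem QsC_mul_conjTranspose (hsub : ∀ y, S₁ y → S₀ y) :
    QsC n M S₀ S₁ * (QsC n M S₀ S₁)ᴴ
      = ((((n : ℝ) ^ d)⁻¹ : ℝ) : ℂ) • (1 : Matrix ({y // S₁ y} ⊕ {x // collarSite n M S₀ S₁ x}) ({y // S₁ y} ⊕ {x // collarSite n M S₀ S₁ x}) ℂ) := by
  have h12 : Q1 n M S₀ S₁ * ((((sC (d := d) n : ℝ) : ℂ) • selS n M S₀ S₁))ᴴ = 0 := by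
    rw [Matrix.conjTranspose_smul, Matrix.mul_smul, Q1_mul_selS_conjTranspose, smul_zero]
  have h21 : (((sC (d := d) n : ℝ) : ℂ) • selS n M S₀ S₁) * (Q1 n M S₀ S₁)ᴴ = 0 := by
    rw [← Matrix.conjTranspose_conjTranspose ((((sC (d := d) n : ℝ) : ℂ) • selS n M S₀ S₁)), ← Matrix.conjTranspose_mul, h12,
      Matrix.conjTranspose_zero]
  have h22 : (((sC (d := d) n : ℝ) : ℂ) • selS n M S₀ S₁) * ((((sC (d := d) n : ℝ) : ℂ) • selS n M S₀ S₁))ᴴ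
      = ((((n : ℝ) ^ d)⁻¹ : ℝ) : ℂ) • 1 := by
    rw [Matrix.conjTranspose_smul, Matrix.smul_mul, Matrix.mul_smul, smul_smul, selS_mul_conjTranspose, Complex.star_def,
      Complex.conj_ofReal, sC_mul_sC]
  rw [QsC, Matrix.conjTranspose_fromRows_eq_fromCols_conjTranspose, Matrix.fromRows_mul_fromCols, Q1_mul_conjTranspose n M S₀ S₁ hsub,
    h12, h21, h22, ← Matrix.fromBlocks_one, Matrix.fromBlocks_smul, smul_zero, smul_zero]

/-- **PRINT's TWO-ZONE SCALAR OPERATOR** `Δ′(Ω₀) = (−Δ + a′Π′)↾Ω₀ + a′n²·1_{Λ₀}` (road P2's `DOm` of the outer region + the (3.24) `j = 0` site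
mass; the block-mass rows on collar blocks are a surplus that vanishes on `N(Q′)`). [cite: Balaban1985BackgroundPropagators, (3.24) p.394 (shape)] [folklore] -/
def DpC : Matrix {x // blockReg n M S₀ x} {x // blockReg n M S₀ x} ℂ :=
  DOm n M a' (blockReg n M S₀) + ((a' * (n : ℝ) ^ 2 : ℝ) : ℂ) • ((selS n M S₀ S₁)ᴴ * selS n M S₀ S₁)

/-- `Δ′(Ω₀)` is Hermitian. [folklore] -/
theorem DpC_isHermitian : (DpC n M a' S₀ S₁).IsHermitian := by
  unfold DpC
  refine (DOm_isHermitian n M a' _).add ?_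
  have h := Matrix.isHermitian_conjTranspose_mul_self (selS n M S₀ S₁)
  unfold Matrix.IsHermitian at h ⊢
  rw [Matrix.conjTranspose_smul, h, Complex.star_def, Complex.conj_ofReal]

/-- **COERCIVITY OF `Δ′(Ω₀)`** with road P2's `γ′ = gammaPs d a′`, uniformly in everything (`0 < a′`). [folklore] -/
theorem coercive_DpC (ha' : 0 < a') : Coercive (DpC n M a' S₀ S₁) (gammaPs d a') := by
  intro lam
  have h1 := coercive_toBlock (blockReg n M S₀) (coercive_DeltaPs n M a' ha') lam
  have h2 : star lam ⬝ᵥ ((((a' * (n : ℝ) ^ 2 : ℝ) : ℂ) • ((selS n M S₀ S₁)ᴴ * selS n M S₀ S₁)) *ᵥ lam)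
      = (((a' * (n : ℝ) ^ 2) * nsq (selS n M S₀ S₁ *ᵥ lam) : ℝ) : ℂ) := by
    rw [Matrix.smul_mulVec, dotProduct_smul, form_gram, smul_eq_mul]; push_cast; ring
  rw [DpC, Matrix.add_mulVec, dotProduct_add, Complex.add_re, h2, Complex.ofReal_re]
  have : 0 ≤ a' * (n : ℝ) ^ 2 * nsq (selS n M S₀ S₁ *ᵥ lam) := by have := nsq_nonneg (selS n M S₀ S₁ *ᵥ lam); positivity
  exact le_trans h1 (by rw [DOm]; linarith)

/-- `Δ′(Ω₀)` is invertible … [folklore] -/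
theorem isUnit_det_DpC (ha' : 0 < a') : IsUnit (DpC n M a' S₀ S₁).det :=
  isUnit_det_of_coercive (gammaPs_pos (d := d) (a' := a')).1 (coercive_DpC n M a' S₀ S₁ ha')

/-- **`G′(Ω₀) = Δ′(Ω₀)⁻¹`**. [cite: Balaban1985BackgroundPropagators, (3.25) p.394 (shape: G′)] [folklore] -/
def GOmC : Matrix {x // blockReg n M S₀ x} {x // blockReg n M S₀ x} ℂ := (DpC n M a' S₀ S₁)⁻¹

/-- … with `‖G′(Ω₀)‖ ≤ γ′⁻¹`. [folklore] -/
theorem opNorm_GOmC_le (ha' : 0 < a') : ‖GOmC n M a' S₀ S₁‖ ≤ (gammaPs d a')⁻¹ :=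
  opNorm_inv_le_of_coercive (gammaPs_pos (d := d) (a' := a')).1 (coercive_DpC n M a' S₀ S₁ ha')

/-- `G′` is Hermitian. [folklore] -/
theorem GOmC_isHermitian : (GOmC n M a' S₀ S₁).IsHermitian := (DpC_isHermitian n M a' S₀ S₁).inv

/-- `Δ′G′ = 1`. [folklore] -/
theorem DpC_mul_GOmC (ha' : 0 < a') : DpC n M a' S₀ S₁ * GOmC n M a' S₀ S₁ = 1 :=
  Matrix.mul_nonsing_inv _ (isUnit_det_DpC n M a' S₀ S₁ ha')

/-- `G′Δ′ = 1`. [folklore] -/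
theorem GOmC_mul_DpC (ha' : 0 < a') : GOmC n M a' S₀ S₁ * DpC n M a' S₀ S₁ = 1 :=
  Matrix.nonsing_inv_mul _ (isUnit_det_DpC n M a' S₀ S₁ ha')

/-- on `N(Q′)` all block means of the OUTER region vanish too (a collar block carries only collar sites). [folklore] -/
theorem QOm_eq_zero_of_ker (lam : {x // blockReg n M S₀ x} → ℂ) (h1 : Q1 n M S₀ S₁ *ᵥ lam = 0) (h2 : selS n M S₀ S₁ *ᵥ lam = 0) :
    QOm n M S₀ *ᵥ lam = 0 := by
  funext y
  by_cases hy : S₁ y.1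
  · have h := congrFun h1 ⟨y.1, hy⟩
    rw [Pi.zero_apply] at h ⊢
    simp only [QOm, Q1, Matrix.mulVec, dotProduct, Matrix.toBlock_apply] at h ⊢
    exact h
  · rw [Pi.zero_apply]
    simp only [QOm, Matrix.mulVec, dotProduct, Matrix.toBlock_apply]
    refine Finset.sum_eq_zero fun x _ => ?_
    by_cases hx : blockOf n M x.1 = y.1
    · have hc : collarSite n M S₀ S₁ x.1 := ⟨x.2, fun h => hy (by have h' : S₁ (blockOf n M x.1) := h; rwa [hx] at h')⟩
      have h := congrFun h2 ⟨x.1, hc⟩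
      rw [selS_mulVec] at h
      simp only [Pi.zero_apply] at h
      rw [h, mul_zero]
    · rw [QsOp_apply_eq_zero n M hx, zero_mul]

/-- **ON `N(Q′)` THE SCALAR OPERATOR IS THE DIRICHLET LAPLACIAN OF THE OUTER REGION**: `Q′λ = 0 → Δ′λ = ∂_{Ω₀}ᴴ(∂_{Ω₀}λ)`.
[cite: Balaban1985BackgroundPropagators, (3.24) p.394 (shape)] [folklore] -/
theorem DpC_mulVec_of_ker (lam : {x // blockReg n M S₀ x} → ℂ) (h : QsC n M S₀ S₁ *ᵥ lam = 0) :
    DpC n M a' S₀ S₁ *ᵥ lam = (gradR n M S₀)ᴴ *ᵥ (gradR n M S₀ *ᵥ lam) := by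
  obtain ⟨h1, h2⟩ := (ker_QsC_iff n M S₀ S₁ lam).mp h
  rw [DpC, Matrix.add_mulVec, Matrix.smul_mulVec, ← Matrix.mulVec_mulVec, h2, Matrix.mulVec_zero, smul_zero, add_zero,
    DOm_mulVec_of_ker n M a' S₀ lam (QOm_eq_zero_of_ker n M S₀ S₁ lam h1 h2)]

end Summit.QuantumFields.BalabanUV.T4Continuum.RegionTwoZoneScalar

end
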